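import Mathlib
import HarnessLib
import Literature.MathematicalPhysics.StatisticalMechanics.WeightTraceBound
import Literature.MathematicalPhysics.StatisticalMechanics.TorusSmoothCutoff
import Literature.MathematicalPhysics.StatisticalMechanics.WeightDataABKM
import Literature.MathematicalPhysics.StatisticalMechanics.WeightDominatingMultipliers

/-!
# Lemma 7.7 (i) for the [ABKM19] weight data on the torus:
# `tr(𝒞_{k+1}^{1/2} A_k^X 𝒞_{k+1}^{1/2}) ≤ c₁ |X|_k` with `c₁` independent of `L`, `N`, `k`

`WeightTraceBound.trace_sqrt_mul_sqrt_le_of_isGradLocal` bounds the trace of a local form dominated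
by `c₀ Σ_α L^{2k(|α|−1)}(∇^α)ᵀ∇^α` against a kernel with geometric derivative bounds, given ANY
cutoff with geometric derivative bounds.  Here everything is instantiated for the weight data
`abkmWeightData` of [ABKM19] (7.2)–(7.5) (`WeightDataABKM.lean`):

* `domScalar_le_div`, `form_le_inv_smul_derivForm` — `A_k^X ⪯ D_k ⪯ λ⁻¹ M_k` ((7.72):
  `d_k = (λm_k⁻¹ + (1+θ_k)t_k)⁻¹ ≤ m_k/λ`, and `mulMat m_k` has the quadratic form of
  `derivForm L k s 1`);
* `cutWidth`, `two_div_cutWidth_le` — the box width `b = max(1, ⌊L^k/(4dM_ord)⌋)` of the cutoff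
  (`TorusSmoothCutoff.cutoff (2M_ord) b X^{++}`) and `2/b ≤ 16dM_ord/L^k` ((7.73) with
  `Θ = 16dM_ord`, independent of `L`);
* `derivSum`, `abs_iterDiff_kernel_le_geometric` — the real-space bounds (iv) of
  `GradientFRD.TorusFRD` (`|∇^θ𝒞_{k+1}| ≤ C(θ,0)L^{−k(d−2+|θ|)}`) in the geometric form
  `C₀ q^{|θ|}`, `C₀ = C_Σ L^{−k(d−2)}`, `q = L^{−k}` ((7.77));
* **`trace_form_abkm_le`** — for `L ≥ 2^{d+3}+16R` and a `k`-polymer `X`: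
  `tr(√C A_k^X √C) ≤ traceConst · |X|_k`, `C = circulant 𝒞_{k+1}`,
  `traceConst = λ⁻¹ (16R)^d C_Σ Σ_{α∈s}(16dM_ord + 1)^{2|α|}` — the bound (7.78) with
  `Ω₁ = traceConst` depending on `d, M_ord, R, λ` and the decomposition's constants only (so the
  block constant `A_𝓑` of (w8) needs no separate treatment).

Everything is proved; no named fact.

## References
* S. Adams, S. Buchholz, R. Kotecký, S. Müller, arXiv:1910.13564, Lemma 7.7 (i), (7.72)–(7.78)
  [AdamsBuchholzKoteckyMuller2019].
-/

noncomputable section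

namespace Literature.MathematicalPhysics.StatisticalMechanics.GradientRG

open Finset Matrix Real
open scoped MatrixOrder
open Literature.MathematicalPhysics.StatisticalMechanics.GradientFRD
  (iterDiff supNorm mulMat fourierCoeff cExt cExt_of_mem circulant_eq_mulMat mulMat_smul
    posSemidef_mulMat posSemidef_mulMat_sub qpow)
open Literature.MathematicalPhysics.StatisticalMechanics.TorusPolymer
  (ball thicken mem_ball mem_thicken thicken_thicken thicken_mono thicken_mono_rad IsPolymer numBlocks)

variable {d M : ℕ} [NeZero M]

/-! ## `A_k^X ⪯ λ⁻¹ M_k` -/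

/-- `d = (λm⁻¹ + (1+θ)t)⁻¹ ≤ m/λ` (with `t = 0` where `m = 0`). [cite: AdamsBuchholzKoteckyMuller2019, Lemma 7.7 (i) (7.72)] -/
theorem domScalar_le_div {lam θ m t : ℝ} (hlam : 0 < lam) (hm : 0 ≤ m) (hθt : 0 ≤ (1 + θ) * t)
    (hmt : m = 0 → t = 0) : domScalar lam θ m t ≤ m / lam := by
  unfold domScalar
  rcases hm.eq_or_lt with h0 | hpos
  · rw [← h0, hmt h0.symm]; simp
  · have h1 : 0 < lam * m⁻¹ := mul_pos hlam (inv_pos.2 hpos)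
    calc (lam * m⁻¹ + (1 + θ) * t)⁻¹ ≤ (lam * m⁻¹)⁻¹ := inv_anti₀ h1 (by linarith)
      _ = m / lam := by rw [mul_inv, inv_inv, div_eq_inv_mul]

/-- **`A_k^X ⪯ λ⁻¹ M_k`** for the multiplier tower: from `A_k^X ⪯ mulMat d_k` (Lemma 7.5 (v)) and
`d_k ≤ m_k/λ`, with `mulMat m_k` the Fourier form of `M_k = derivForm L k s 1` ((7.72)).
[cite: AdamsBuchholzKoteckyMuller2019, Lemma 7.7 (i) (7.72)] -/
theorem form_le_inv_smul_derivForm (W : WeightData (Fin d → ZMod M)) {L lam : ℝ} (hL : 0 ≤ L)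
    (hlam : 0 < lam) {θ : ℕ → ℝ} {s : Finset (Fin d → ℕ)} {t : ℕ → (Fin d → ZMod M) → ℝ}
    (hD : W.Dominated fun k => mulMat (domMul lam θ (fun k => derivMul L k s) t k))
    (hθ : ∀ k, 0 ≤ 1 + θ k) (ht_nonneg : ∀ k κ, 0 ≤ t k κ) (ht_zero : ∀ k, t k 0 = 0)
    (hs1 : ∀ i : Fin d, (Pi.single i 1 : Fin d → ℕ) ∈ s) (k : ℕ) (X : Finset (Fin d → ZMod M)) :
    (lam⁻¹ • derivForm L k s (fun _ => (1 : ℝ)) - W.form k X).PosSemidef := by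
  have h1 := WeightData.form_le hD k X
  have h2 : (mulMat (fun κ => lam⁻¹ * derivMul L k s κ) -
      mulMat (domMul lam θ (fun k => derivMul L k s) t k)).PosSemidef := by
    refine posSemidef_mulMat_sub fun κ => ?_
    rw [domMul, ← div_eq_inv_mul]
    refine domScalar_le_div hlam (derivMul_nonneg hL k s κ) (mul_nonneg (hθ k) (ht_nonneg k κ))
      fun h0 => ?_
    by_cases hκ : κ = 0
    · rw [hκ]; exact ht_zero k
    · exact absurd h0 (derivMul_pos hL k hs1 hκ).ne'
  have h12 := h2.add h1
  rw [sub_add_sub_cancel] at h12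
  -- transfer through the equality of quadratic forms `derivForm 1 ~ mulMat m`
  refine Matrix.PosSemidef.of_dotProduct_mulVec_nonneg ?_ fun φ => ?_
  · rw [isHermitian_iff_isSymm]
    exact ((isSymm_derivForm L k s _).smul _).sub (WeightData.form_isSymm hD k X)
  · have := h12.dotProduct_mulVec_nonneg φ
    rw [star_trivial] at this ⊢
    rw [Matrix.sub_mulVec, dotProduct_sub, Matrix.smul_mulVec, dotProduct_smul, smul_eq_mul,
      dotProduct_derivForm_one_eq_mulMat]
    rw [Matrix.sub_mulVec, dotProduct_sub, mulMat_smul, Matrix.smul_mulVec, dotProduct_smul,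
      smul_eq_mul] at this
    exact this

/-! ## The cutoff width -/

/-- The box width `b_k = max(1, ⌊L^k/c⌋)`. [cite: AdamsBuchholzKoteckyMuller2019, Lemma 7.7 (i) (7.73)] -/
def cutWidth (c L k : ℕ) : ℕ := max 1 (L ^ k / c)

/-- `b_k ≥ 1`. [cite: AdamsBuchholzKoteckyMuller2019, Lemma 7.7 (i) (7.73)] -/
theorem one_le_cutWidth (c L k : ℕ) : 1 ≤ cutWidth c L k := le_max_left _ _

/-- `c(b_k − 1) ≤ L^k`. [cite: AdamsBuchholzKoteckyMuller2019, Lemma 7.7 (i) (7.73)] -/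
theorem mul_cutWidth_sub_one_le (c L k : ℕ) : c * (cutWidth c L k - 1) ≤ L ^ k := by
  unfold cutWidth
  have h1 : max 1 (L ^ k / c) - 1 ≤ L ^ k / c := by
    rcases le_total 1 (L ^ k / c) with h | h
    · rw [max_eq_right h]; omega
    · rw [max_eq_left h]; exact Nat.zero_le _
  exact (Nat.mul_le_mul_left c h1).trans (Nat.mul_div_le _ _)

/-- **`2/b_k ≤ 4c/L^k`** (`c, L ≥ 1`): the derivative cost of the cutoff is `Θ L^{−k}` with `Θ = 4c`
independent of `L`. [cite: AdamsBuchholzKoteckyMuller2019, Lemma 7.7 (i) (7.73)] -/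
theorem two_div_cutWidth_le {c L : ℕ} (hc : 1 ≤ c) (hL : 1 ≤ L) (k : ℕ) :
    (2 : ℝ) / (cutWidth c L k : ℝ) ≤ 4 * c / (L : ℝ) ^ k := by
  have hLk : (1 : ℝ) ≤ (L : ℝ) ^ k := one_le_pow₀ (by exact_mod_cast hL)
  have hb1 : (1 : ℝ) ≤ cutWidth c L k := by exact_mod_cast one_le_cutWidth c L k
  have hcr : (1 : ℝ) ≤ c := by exact_mod_cast hc
  rw [div_le_div_iff₀ (by linarith) (by linarith)]
  by_cases hsmall : L ^ k < 2 * c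
  · -- `2 L^k ≤ 4c ≤ 4c·b`
    have : ((L ^ k : ℕ) : ℝ) < 2 * c := by exact_mod_cast hsmall
    push_cast at this
    nlinarith
  · -- `b = ⌊L^k/c⌋ ≥ L^k/c − 1 ≥ L^k/(2c)`
    have hsmall : 2 * c ≤ L ^ k := not_lt.1 hsmall
    have hdiv : L ^ k / c ≤ cutWidth c L k := le_max_right _ _
    have hfloor : (L : ℝ) ^ k ≤ c * ((L ^ k / c : ℕ) : ℝ) + c := by
      have h := Nat.lt_div_mul_add (a := L ^ k) hc
      have : ((L ^ k : ℕ) : ℝ) < ((L ^ k / c * c + c : ℕ) : ℝ) := by exact_mod_cast h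
      push_cast at this; linarith
    have hdiv' : ((L ^ k / c : ℕ) : ℝ) ≤ cutWidth c L k := by exact_mod_cast hdiv
    have h2c : (2 : ℝ) * c ≤ (L : ℝ) ^ k := by exact_mod_cast hsmall
    nlinarith

/-! ## Kernel bounds in geometric form -/

/-- `C_Σ = Σ_{θ_i ≤ n} |C(θ,0)|` — a common bound for the constants of (iv) up to order `n`.
[cite: AdamsBuchholzKoteckyMuller2019, Lemma 7.7 (i) (7.77)] -/
def derivSum (d n : ℕ) (Cα : (Fin d → ℕ) → ℕ → ℝ) : ℝ :=
  ∑ θ ∈ Fintype.piFinset fun _ : Fin d => Finset.range (n + 1), |Cα θ 0|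

omit [NeZero M] in
/-- `C(θ,0) ≤ C_Σ` for `|θ| ≤ n`. [cite: AdamsBuchholzKoteckyMuller2019, Lemma 7.7 (i) (7.77)] -/
theorem le_derivSum {n : ℕ} (Cα : (Fin d → ℕ) → ℕ → ℝ) {θ : Fin d → ℕ} (hθ : ∑ i, θ i ≤ n) :
    Cα θ 0 ≤ derivSum d n Cα := by
  refine (le_abs_self _).trans (Finset.single_le_sum (f := fun θ => |Cα θ 0|) (fun _ _ => abs_nonneg _) ?_)
  rw [Fintype.mem_piFinset]
  intro i
  rw [Finset.mem_range]
  have := Finset.single_le_sum (f := θ) (fun j _ => Nat.zero_le _) (mem_univ i)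
  omega

omit [NeZero M] in
/-- `C_Σ ≥ 0`. [cite: AdamsBuchholzKoteckyMuller2019, Lemma 7.7 (i) (7.77)] -/
theorem derivSum_nonneg (d n : ℕ) (Cα : (Fin d → ℕ) → ℕ → ℝ) : 0 ≤ derivSum d n Cα :=
  Finset.sum_nonneg fun _ _ => abs_nonneg _

omit [NeZero M] in
/-- **(iv) in geometric form**: `|∇^θ𝒞(x)| ≤ C(θ,0)/L^{k(d−2+|θ|)}` for `|θ| ≤ n` gives
`|∇^θ𝒞| ≤ (C_Σ/L^{k(d−2)}) · (1/L^k)^{|θ|}` (`L ≥ 1`).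
[cite: AdamsBuchholzKoteckyMuller2019, Lemma 7.7 (i) (7.77)] -/
theorem abs_iterDiff_kernel_le_geometric {L n k : ℕ} (hL : 1 ≤ L)
    {Cα : (Fin d → ℕ) → ℕ → ℝ} {𝒞 : (Fin d → ZMod M) → ℝ}
    (hreg : ∀ θ : Fin d → ℕ, ∑ i, θ i ≤ n → ∀ x,
      |iterDiff θ 𝒞 x| ≤ Cα θ 0 / (L : ℝ) ^ ((k + 1 - 1) * (d - 2 + ∑ i, θ i)))
    (θ : Fin d → ℕ) (hθ : ∑ i, θ i ≤ n) (x : Fin d → ZMod M) :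
    |iterDiff θ 𝒞 x| ≤ derivSum d n Cα / (L : ℝ) ^ (k * (d - 2)) * ((L : ℝ) ^ k)⁻¹ ^ (∑ i, θ i) := by
  have hL0 : (0 : ℝ) < L := by exact_mod_cast hL
  refine (hreg θ hθ x).trans ?_
  have hD : (L : ℝ) ^ ((k + 1 - 1) * (d - 2 + ∑ i, θ i)) =
      (L : ℝ) ^ (k * (d - 2)) * ((L : ℝ) ^ k) ^ (∑ i, θ i) := by
    rw [Nat.add_sub_cancel, mul_add, pow_add]
    congr 1
    exact pow_mul _ _ _
  rw [hD, inv_pow, ← one_div, mul_one_div, div_div]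
  exact div_le_div_of_nonneg_right (le_derivSum Cα hθ) (by positivity)

/-! ## The trace bound for `abkmWeightData` -/

/-- The constant `c₁ = λ⁻¹ (16R)^d C_Σ Σ_{α∈s} (16dM_ord + 1)^{2|α|}` of Lemma 7.7 (i) ((7.78) `Ω₁`),
independent of `L`, `N`, `k`. [cite: AdamsBuchholzKoteckyMuller2019, Lemma 7.7 (i) (7.78)] -/
def traceConst (d Mord R : ℕ) (lam CS : ℝ) : ℝ :=
  lam⁻¹ * ((16 * R : ℕ) : ℝ) ^ d * CS *
    ∑ α ∈ diffIndex d Mord, ((16 * d * Mord + 1 : ℕ) : ℝ) ^ (2 * ∑ i, α i)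

/-- **[ABKM19] Lemma 7.7 (i) for the weight data on the torus.** For odd `L ≥ 2^{d+3} + 16R`
(`1 ≤ M_ord ≤ R`, `d ≥ 2`), the weight data `abkmWeightData L N Mord R θ̄ δ' 𝒞` dominated by the
multiplier sequence (`WeightDataABKMDominated`), a scale `k` with `k + 1 ≤ N + 1`, a `k`-polymer `X`
(union of blocks of side `L^k`), and the step kernel `𝒞_{k+1}` even with non-negative multipliers
and the real-space bounds (iv) up to order `n ≥ 2M_ord`:
`tr(√C A_k^X √C) ≤ traceConst · |X|_k`, `C = circulant 𝒞_{k+1}`.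
[cite: AdamsBuchholzKoteckyMuller2019, Lemma 7.7 (i) (7.78)] -/
theorem trace_form_abkm_le {L N Mord R : ℕ} (hd : 2 ≤ d) (hMord : 1 ≤ Mord) (hMR : Mord ≤ R)
    (hLodd : Odd L) (hL : 2 ^ (d + 3) + 16 * R ≤ L) {θbar : ℝ} {δ' : ℕ → ℝ} {𝒞 : ℕ → (Fin d → ZMod M) → ℝ}
    {lam : ℝ} (hlam : 0 < lam) {θ : ℕ → ℝ} (hθ : ∀ k, 0 ≤ 1 + θ k)
    (hnn : ∀ (j : ℕ) (κ : Fin d → ZMod M), 0 ≤ cExt N (fun j => fourierCoeff (𝒞 j) κ) j)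
    (hf_zero : ∀ j : ℕ, cExt N (fun j => fourierCoeff (𝒞 j) (0 : Fin d → ZMod M)) j = 0)
    (hD : (abkmWeightData L N Mord R θbar δ' 𝒞).Dominated fun k =>
      mulMat (domMul lam θ (fun k => derivMul (L : ℝ) k (diffIndex d Mord))
        (tailMul N fun κ j => fourierCoeff (𝒞 j) κ) k))
    {k : ℕ} (hk : k + 1 ≤ N + 1) (heven : ∀ x, 𝒞 (k + 1) (-x) = 𝒞 (k + 1) x)
    {n : ℕ} (hn : 2 * Mord ≤ n) {Cα : (Fin d → ℕ) → ℕ → ℝ}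
    (hreg : ∀ θ : Fin d → ℕ, ∑ i, θ i ≤ n → ∀ x,
      |iterDiff θ (𝒞 (k + 1)) x| ≤ Cα θ 0 / (L : ℝ) ^ ((k + 1 - 1) * (d - 2 + ∑ i, θ i)))
    {X : Finset (Fin d → ZMod M)} (hX : IsPolymer (L ^ k) X) :
    (CFC.sqrt (Matrix.circulant (𝒞 (k + 1))) * (abkmWeightData L N Mord R θbar δ' 𝒞).form k X *
        CFC.sqrt (Matrix.circulant (𝒞 (k + 1)))).trace ≤
      traceConst d Mord R lam (derivSum d n Cα) * numBlocks (L ^ k) X := by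
  -- parameters
  have hR : 1 ≤ R := hMord.trans hMR
  have hL8 : 2 ^ (d + 3) ≤ L := le_trans (Nat.le_add_right _ _) hL
  have hL1 : 1 ≤ L := le_trans Nat.one_le_two_pow hL8
  have hLM : Mord ≤ L := by
    have : 16 * R ≤ L := le_trans (Nat.le_add_left _ _) hL
    omega
  have h3L : 2 ^ d + 3 * R ≤ 3 * L := by
    have : 2 ^ d ≤ 2 ^ (d + 3) := Nat.pow_le_pow_right (by norm_num) (by omega)
    omega
  have hLr : (1 : ℝ) ≤ L := by exact_mod_cast hL1
  have hY : (0 : ℝ) < (L : ℝ) ^ k := by positivity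
  have hY1 : (1 : ℝ) ≤ (L : ℝ) ^ k := one_le_pow₀ hLr
  set W := abkmWeightData L N Mord R θbar δ' 𝒞 with hW
  set s := diffIndex d Mord with hsdef
  have hs1 : ∀ α ∈ s, 1 ≤ ∑ i, α i := fun α hα => (mem_diffIndex.1 hα).1
  have hsM : ∀ α ∈ s, ∑ i, α i ≤ Mord := fun α hα => (mem_diffIndex.1 hα).2
  -- the form: symmetric, local on `S = X + [−nbRad_k, nbRad_k]^d`, `⪯ λ⁻¹ M_k`
  set S := thicken (nbRad R L k) X with hS
  have hAs : (W.form k X).IsSymm := WeightData.form_isSymm hD k X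
  have hloc : IsGradLocal (W.form k X) S :=
    WeightData.form_isGradLocal (local_abkmWeightData N hMord hMR hLM h3L θbar δ' 𝒞) k X
  have hAB : (lam⁻¹ • derivForm (L : ℝ) k s (fun _ => (1 : ℝ)) - W.form k X).PosSemidef := by
    refine form_le_inv_smul_derivForm W (Nat.cast_nonneg L) hlam hD hθ
      (fun k κ => tailMul_nonneg (fun κ j => hnn j κ) k κ) (fun k => ?_)
      (fun i => single_mem_diffIndex hMord i) k X
    unfold tailMul; exact Finset.sum_eq_zero fun j _ => hf_zero j
  -- the cutoff
  set b := cutWidth (4 * d * Mord) L k with hb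
  have hb1 : 1 ≤ b := one_le_cutWidth _ L k
  set ρ := d * (2 * Mord * (b - 1)) with hρ
  have h2ρ : ρ + ρ ≤ L ^ k := by
    have := mul_cutWidth_sub_one_le (4 * d * Mord) L k
    rw [hρ]; rw [← hb] at this; nlinarith [this]
  set χ := cutoff (2 * Mord) b S with hχdef
  have hχS : ∀ x ∈ S, χ x = 1 := fun x hx => cutoff_eq_one hb1 hx
  set p : ℝ := 2 / (b : ℝ) with hp
  have hχ : ∀ β : Fin d → ℕ, ∑ i, β i ≤ 2 * Mord → ∀ y, |iterDiff β χ y| ≤ p ^ (∑ i, β i) :=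
    fun β hβ y => abs_iterDiff_cutoff_le hb1 S (fun i => le_trans
      (Finset.single_le_sum (f := β) (fun j _ => Nat.zero_le _) (mem_univ i)) hβ) y
  have hp_le : p ≤ 4 * ((4 * d * Mord : ℕ) : ℝ) / (L : ℝ) ^ k :=
    two_div_cutWidth_le (by nlinarith [hMord, show 1 ≤ d by omega]) hL1 k
  have hp0 : 0 ≤ p := by rw [hp]; positivity
  -- the kernel
  have hCeq : Matrix.circulant (𝒞 (k + 1)) =
      mulMat fun κ => cExt N (fun j => fourierCoeff (𝒞 j) κ) (k + 1) := by
    rw [circulant_eq_mulMat heven]; congr 1; funext κ; rw [cExt_of_mem (by omega) hk]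
  have hCpsd : (Matrix.circulant (𝒞 (k + 1))).PosSemidef := by
    rw [hCeq]; exact posSemidef_mulMat fun κ => hnn (k + 1) κ
  set q : ℝ := ((L : ℝ) ^ k)⁻¹ with hq
  set C₀ : ℝ := derivSum d n Cα / (L : ℝ) ^ (k * (d - 2)) with hC₀
  have h𝒞 : ∀ θ' : Fin d → ℕ, ∑ i, θ' i ≤ 2 * Mord → ∀ w,
      |iterDiff θ' (𝒞 (k + 1)) w| ≤ C₀ * q ^ (∑ i, θ' i) :=
    fun θ' hθ' w => abs_iterDiff_kernel_le_geometric hL1 hreg θ' (hθ'.trans hn) w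
  -- the abstract trace bound
  have hmain := trace_sqrt_mul_sqrt_le_of_isGradLocal hloc hAs hχS hχ hsM (inv_pos.2 hlam).le
    (Nat.cast_nonneg L) hAB hCpsd h𝒞
  refine hmain.trans ?_
  -- counting: `#(supp χ + [−Mord, Mord]^d) ≤ (16R)^d L^{kd} |X|_k`
  have hsupp : (univ.filter fun y => χ y ≠ 0) ⊆ thicken (ρ + ρ) S := by
    intro y hy
    rw [mem_filter] at hy
    by_contra hcon
    exact hy.2 (cutoff_eq_zero hb1 hcon)
  have hU : thicken Mord (univ.filter fun y => χ y ≠ 0) ⊆ thicken (4 * L ^ k + 3 * R) X := by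
    refine (thicken_mono _ hsupp).trans ((thicken_thicken _ _ _).trans
      ((thicken_thicken _ _ _).trans (thicken_mono_rad ?_ X)))
    have : nbRad R L k ≤ 3 * L ^ k + 2 * R := by
      cases k with
      | zero => simp [nbRad]
      | succ k => simp [nbRad]
    omega
  have hcount : ((thicken Mord (univ.filter fun y => χ y ≠ 0)).card : ℝ) ≤
      ((16 * R : ℕ) : ℝ) ^ d * (L : ℝ) ^ (k * d) * numBlocks (L ^ k) X := by
    have h1 := (Finset.card_le_card hU).trans (hX.card_thicken_le hLodd.pow (4 * L ^ k + 3 * R))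
    have h2 : 2 * (4 * L ^ k + 3 * R + (L ^ k - 1)) + 1 ≤ 16 * R * L ^ k := by
      obtain ⟨t, ht⟩ : ∃ t, L ^ k = t + 1 := ⟨L ^ k - 1, (Nat.sub_add_cancel (Nat.one_le_pow _ _ hL1)).symm⟩
      rw [ht, Nat.add_sub_cancel]
      have : t ≤ R * t := Nat.le_mul_of_pos_left t hR
      nlinarith
    have h3 : numBlocks (L ^ k) X * (2 * (4 * L ^ k + 3 * R + (L ^ k - 1)) + 1) ^ d ≤
        numBlocks (L ^ k) X * (16 * R * L ^ k) ^ d :=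
      Nat.mul_le_mul_left _ (Nat.pow_le_pow_left h2 d)
    have h4 : ((thicken Mord (univ.filter fun y => χ y ≠ 0)).card : ℝ) ≤
        ((numBlocks (L ^ k) X * (16 * R * L ^ k) ^ d : ℕ) : ℝ) := by exact_mod_cast h1.trans h3
    refine h4.trans (le_of_eq ?_)
    push_cast
    rw [mul_pow, ← pow_mul]; ring
  -- the sum over `α`: `L^{2k(|α|−1)} (p+q)^{2|α|} ≤ Θ₁^{2|α|} q²`, `Θ₁ = 16dM_ord + 1`
  set Θ₁ : ℝ := ((16 * d * Mord + 1 : ℕ) : ℝ) with hΘ₁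
  have hpq : p + q ≤ Θ₁ * q := by
    rw [hΘ₁, hq]; push_cast
    have : p ≤ 16 * (d : ℝ) * Mord * ((L : ℝ) ^ k)⁻¹ := by
      refine hp_le.trans (le_of_eq ?_); push_cast; rw [div_eq_mul_inv]; ring
    nlinarith [inv_pos.2 hY]
  have hterm : ∀ α ∈ s, (L : ℝ) ^ (2 * k * (∑ i, α i - 1)) * (p + q) ^ (2 * ∑ i, α i) ≤
      Θ₁ ^ (2 * ∑ i, α i) * q ^ 2 := by
    intro α hα
    have hn1 := hs1 α hα
    have h1 : (p + q) ^ (2 * ∑ i, α i) ≤ (Θ₁ * q) ^ (2 * ∑ i, α i) :=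
      pow_le_pow_left₀ (by positivity) hpq _
    refine (mul_le_mul_of_nonneg_left h1 (by positivity)).trans (le_of_eq ?_)
    -- `L^{2k(n−1)} (Θ₁ q)^{2n} = Θ₁^{2n} q² · (L^k q)^{2(n−1)}` and `L^k q = 1`
    obtain ⟨n', hn'⟩ : ∃ n', ∑ i, α i = n' + 1 := ⟨∑ i, α i - 1, by omega⟩
    rw [hn', Nat.add_sub_cancel, show 2 * k * n' = k * (2 * n') by ring, pow_mul, mul_pow, hq,
      show 2 * (n' + 1) = 2 * n' + 2 by ring, pow_add, pow_add, inv_pow, inv_pow]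
    field_simp
  have hsum : ∑ α ∈ s, (L : ℝ) ^ (2 * k * (∑ i, α i - 1)) * (p + q) ^ (2 * ∑ i, α i) ≤
      q ^ 2 * ∑ α ∈ s, Θ₁ ^ (2 * ∑ i, α i) := by
    rw [Finset.mul_sum]
    exact Finset.sum_le_sum fun α hα => (hterm α hα).trans (le_of_eq (by ring))
  -- assemble: all powers of `L^k` cancel
  have hC₀0 : 0 ≤ C₀ := by rw [hC₀]; exact div_nonneg (derivSum_nonneg d n Cα) (by positivity)
  have hK₂0 : 0 ≤ ∑ α ∈ s, Θ₁ ^ (2 * ∑ i, α i) := Finset.sum_nonneg fun _ _ => by positivity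
  have hnum0 : (0 : ℝ) ≤ numBlocks (L ^ k) X := Nat.cast_nonneg _
  calc lam⁻¹ * ((thicken Mord (univ.filter fun y => χ y ≠ 0)).card : ℝ) * C₀ *
        ∑ α ∈ s, (L : ℝ) ^ (2 * k * (∑ i, α i - 1)) * (p + q) ^ (2 * ∑ i, α i)
      ≤ lam⁻¹ * (((16 * R : ℕ) : ℝ) ^ d * (L : ℝ) ^ (k * d) * numBlocks (L ^ k) X) * C₀ *
          (q ^ 2 * ∑ α ∈ s, Θ₁ ^ (2 * ∑ i, α i)) := by
        gcongr
    _ = traceConst d Mord R lam (derivSum d n Cα) * numBlocks (L ^ k) X := by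
        rw [traceConst, hC₀, hq, ← hsdef, ← hΘ₁]
        have hYd : (L : ℝ) ^ (k * d) = (L : ℝ) ^ (k * (d - 2)) * ((L : ℝ) ^ k) ^ 2 := by
          rw [← pow_mul, ← pow_add]; congr 1
          zify [hd]; ring
        rw [hYd]
        field_simp

end Literature.MathematicalPhysics.StatisticalMechanics.GradientRG

end
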